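import Summits.CriticalPhenomena.SAWScalingLimit.Theorems.SAWLoopFugacityFlowAvoidanceLimitAnchorDefs
import Summits.CriticalPhenomena.SAWScalingLimit.Theorems.SAWLoopFugacityFlowAvoidanceLimitSawEndpoint
import Literature.Probability.LatticeModels.DiluteLoopModelAnalyticity

/-!
# Monotonicity of the dilute loop model partition function in the graph —
helper of the lever `stub_cornerLipschitz` of line `saw-corner-germ`
(crux `SAWLoopFugacityFlow.AvoidanceLimit`, stmt-CriticalPhenomena-10649)

An elementary fact about the tree's dilute loop model `Z_{n,w,x}(G, Λ; A)`
(`DiluteLoopModel.partitionFunction`) used by the corner line at `n ≥ 0`, where the Anchor ratio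
`Rδ n 0 x Ω S δ a b` has its numerator on the CONFINED graph, a subgraph of `Ω_δ`:
`partitionFunction_mono_graph` — for nonnegative parameters the partition function is monotone in the graph
(a subgraph has fewer admissible edge sets; the weight `x^{|F|} w^{N(F)} n^{loops(F,S)}` of a resolved
configuration does not depend on the ambient graph), so the confined two-leg and vacuum partition functions
are bounded by the unconfined ones (`dimerPF_zero_confined_le`). Positivity of the same objects is in the
sibling file `…CritLineWellPosed.lean` (`dimerPF_dimerFugacity_zero_nonneg`, `ratio_dimerFugacity_zero_nonneg`).

Sources: W. Guo, H. W. J. Blöte, B. Nienhuis, Int. J. Mod. Phys. C 10 (1999) 301, §1 eq. (1)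
[GuoBloteNienhuis1999]; N. Madras, G. Slade, *The Self-Avoiding Walk* (1993), §1.2 [MadrasSlade1993].
No new definitions; nothing about the scaling limit is asserted here.
-/

noncomputable section

open Finset
open scoped symmDiff
open Literature.Probability.RandomPlanarGeometry Literature.Probability.LatticeModels
open Summit.CriticalPhenomena.SAWScalingLimit.Theorems.AvoidanceLimit.Anchor

namespace Summit.CriticalPhenomena.SAWScalingLimit.Theorems.AvoidanceLimit.Corner

/-! ## Monotonicity of the partition function in the graph -/

/-- A subgraph has fewer edges inside `Λ`. [folklore] -/
theorem edgesIn_mono_graph {H' H : SimpleGraph (Site 2)} [H'.LocallyFinite] [H.LocallyFinite]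
    (hle : H' ≤ H) (Λ : Finset (Site 2)) : edgesIn H' Λ ⊆ edgesIn H Λ := by
  intro e he
  rw [mem_edgesIn_iff] at he ⊢
  exact ⟨SimpleGraph.edgeSet_mono hle he.1, he.2⟩

/-- A subgraph has fewer admissible configurations with a given source set (the parity condition does
not mention the graph). [folklore] -/
theorem configs_mono_graph {H' H : SimpleGraph (Site 2)} [H'.LocallyFinite] [H.LocallyFinite]
    (hle : H' ≤ H) (Λ A : Finset (Site 2)) :
    DiluteLoopModel.configs H' Λ A ⊆ DiluteLoopModel.configs H Λ A := by
  intro F hF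
  rw [DiluteLoopModel.mem_configs] at hF ⊢
  exact ⟨hF.1.trans (edgesIn_mono_graph hle Λ), hF.2⟩

/-- **Monotonicity of `Z_{n,w,x}(G, Λ; A)` in the graph `G`** for nonnegative parameters: the weight
`x^{|F|} w^{N(F)} n^{loops(F,S)}` of a resolved configuration does not depend on the ambient graph, and a
subgraph admits fewer configurations. [cite: GuoBloteNienhuis1999, §1 eq. (1)] -/
theorem partitionFunction_mono_graph :
    ∀ (H' H : SimpleGraph (Site 2)) [H'.LocallyFinite] [H.LocallyFinite], H' ≤ H →
      ∀ (n w x : ℝ), 0 ≤ n → 0 ≤ w → 0 ≤ x → ∀ (Λ A : Finset (Site 2)),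
        (⟨n, w, x⟩ : DiluteLoopModel ℝ).partitionFunction H' Λ A ≤
          (⟨n, w, x⟩ : DiluteLoopModel ℝ).partitionFunction H Λ A := by
  intro H' H _ _ hle n w x hn hw hx Λ A
  unfold DiluteLoopModel.partitionFunction
  refine sum_le_sum_of_subset_of_nonneg (configs_mono_graph hle Λ A) ?_
  intro F _ _
  exact sum_nonneg fun S _ => DiluteLoopModel.weight_nonneg hn hw hx Λ F S

/-! ## The confined partition functions are dominated by the unconfined ones -/

/-- The confined dressed partition functions are bounded by the unconfined ones (`t = 0`, `n, x ≥ 0`):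
the confined graph is a subgraph of `Ω_δ` (`Anchor.confinedGraph_le`). [folklore] -/
theorem dimerPF_zero_confined_le {n x : ℝ} (hn : 0 ≤ n) (hx : 0 ≤ x) (Ω S : Set ℂ) (δ : ℝ)
    (Λ A : Finset (Site 2)) :
    dimerPF n 0 x (confinedGraph Ω S δ) Λ A ≤ dimerPF n 0 x (discreteDomainGraph Ω δ) Λ A := by
  rw [dimerPF_dimerFugacity_zero, dimerPF_dimerFugacity_zero]
  exact partitionFunction_mono_graph _ _ (confinedGraph_le Ω S δ) n 0 x hn le_rfl hx Λ A

end Summit.CriticalPhenomena.SAWScalingLimit.Theorems.AvoidanceLimit.Corner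

end
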